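import Summits.HodgeConjecture.HodgeConjecture.Theorems.BoundaryReadoutAbsoluteReduction
import Summits.HodgeConjecture.HodgeConjecture.Theorems.PadicSemiregularLiftHodgeAbelianVarietiesStubWeilSectorSuffices
import Summits.HodgeConjecture.HodgeConjecture.Theses.PadicSemiregularLift
import Summits.HodgeConjecture.HodgeConjecture.Theses.HeckeOrbitCompactness
import Literature.AlgebraicGeometry.HodgeTheory.LefschetzStandardConjectureFacts
import Literature.AlgebraicGeometry.HodgeTheory.MotivatedClasses
import Literature.AlgebraicGeometry.Motives.AbelianVarietyProjectiveChart
import HarnessLib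

/-!
# Route `BoundaryReadout` — crux `HCOverNumberFields` (stmt-HodgeConjecture-1070) settles the Hodge
# conjecture for EVERY complex abelian variety (CONDITIONAL on three theorems in print)

The shared crux `BoundaryReadout.HCOverNumberFields` (= `QbarEnvelope.HCOverNumberFields`,
stmt-HodgeConjecture-1070: the Hodge conjecture for smooth projective complex varieties definable over
a number field; ⟺ `PeriodDeficiency.HodgeConjectureQbar`, stmt-HodgeConjecture-11596, by the landed
`hcOverNumberFields_iff_hodgeConjectureQbar`) is an OPEN PROBLEM and this file does not claim it. It
lands, attached to the item, the formal version of the remark in the item's docstring that its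
"decisive open sub-family" is the abelian one — in the strong, NON-arithmetic form:

  `HCOverNumberFields ⟹ PadicSemiregularLift.HodgeAbelianVarieties` (stmt-HodgeConjecture-1333:
  `∀ A : AbelianVariety ℂ, HodgeConjectureFor A.dim A.X`, the Hodge conjecture for every complex
  abelian variety, arithmetic or not) `⟹ WeilClassesAlgebraic` (stmt-HodgeConjecture-2522, the shared
  target of routes `TropicalCuspLift` / `HeckeOrbitCompactness`),

conditional on three Literature named facts (theorems in print, vendored, not yet discharged):

* `voisin2007_hodgeConjecture_absolute_of_qbar` — C. Voisin, *Hodge loci and absolute Hodge classes*,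
  Compositio Math. 143 (2007), Prop. 1.2: the Hodge conjecture for absolute Hodge classes on
  `ℚ̄`-varieties gives it for absolute Hodge classes on all smooth projective complex varieties
  (consumed through the landed `absoluteReduction_of_voisin2007`);
* `Andre1996_hodgeClasses_abelianVariety_motivated` — Y. André, *Pour une théorie inconditionnelle des
  motifs*, Publ. Math. IHÉS 83 (1996), Thm. 0.6.2: Hodge classes on complex abelian varieties are
  motivated;
* `Andre1996_isAbsoluteHodgeClass_of_mem_motivatedClasses` — André 1996, Prop. 2.5.1: rational
  motivated classes are absolute Hodge classes (de Rham formulation, Charles–Schnell Def. 11.2.3).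

Chain: `HCOverNumberFields` ⟹ (transfer to `ℚ̄` + Voisin) every absolute Hodge class on every smooth
projective complex variety is algebraic (`BoundaryReadout.AbsoluteReduction`) ⟹ (André, twice) every
rational `(p,p)` class on every complex abelian variety is algebraic; the anti-vacuity conjunct
`Nonempty (HodgeModel A.dim A.X)` is the discharged `nonempty_hodgeModel_holds`, abelian varieties being
smooth projective unconditionally (`AbelianVariety.isSmoothProjective_holds`). Classically the middle
step is Deligne 1982, Thm. 2.11 (Hodge classes on abelian varieties are absolute Hodge); the tree routes
it through André's two statements, which are the vendored ones.

So ONE proof of stmt-1070 (equivalently of stmt-11596) closes stmt-1333 and stmt-2522 as well, modulo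
the three facts; conversely nothing here bears on stmt-1070 itself, whose kernel (Weil classes on CM
abelian varieties of Weil type, dimension `≥ 6`) sits inside stmt-2522.

## References

* [Voisin2007HodgeLoci] C. Voisin, Compositio Math. 143 (2007), Prop. 1.2, Rem. 1.4.
* [Andre1996Motifs] Y. André, Publ. Math. IHÉS 83 (1996), Thm. 0.6.2, Prop. 2.5.1, §6.3.
* [Deligne1982HodgeCycles] P. Deligne, LNM 900 (1982), Thm. 2.11.
* [Weil1977HodgeRing] A. Weil, Abelian varieties and the Hodge ring, Œuvres III (1977).
-/

-- `Summit.<Summit>.<Problem>` is the mandated summit-side namespace (CONVENTIONS §2); for the single-conjunct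
-- summit `HodgeConjecture` the duplicate `HodgeConjecture.HodgeConjecture` is deliberate.
set_option linter.dupNamespace false

noncomputable section

namespace Summit.HodgeConjecture.HodgeConjecture.Theorems

open CategoryTheory AlgebraicGeometry
open Literature.AlgebraicGeometry Literature.AlgebraicGeometry.Motives
open Literature.AlgebraicGeometry.HodgeTheory
open Summit.HodgeConjecture.HodgeConjecture.Theses

/-! ### 1. Deligne's question ⇒ the Hodge conjecture for abelian varieties (André) -/

/-- **If every absolute Hodge class on every smooth projective complex variety is algebraic, the Hodge
conjecture holds for every complex abelian variety** (CONDITIONAL on André 1996, Thm. 0.6.2 and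
Prop. 2.5.1, vendored named facts): a rational `(p,p)` class on `A` is motivated (Thm. 0.6.2), hence
absolute Hodge (Prop. 2.5.1), hence algebraic by the hypothesis; `A` is smooth projective of dimension
`A.dim` (`AbelianVariety.isSmoothProjective_holds`) and has a Hodge model (`nonempty_hodgeModel_holds`).
[cite: Andre1996Motifs, Thm. 0.6.2 and Prop. 2.5.1] -/
theorem hodgeAbelianVarieties_of_absoluteHodge_algebraic
    (hA₁ : Andre1996_hodgeClasses_abelianVariety_motivated)
    (hA₂ : Andre1996_isAbsoluteHodgeClass_of_mem_motivatedClasses)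
    (habs : ∀ ⦃n : ℕ⦄ ⦃X : SchemeOver ℂ⦄, IsSmoothProjective n X →
      ∀ (p : ℕ) (c : complexBetti X (2 * p)), IsAbsoluteHodgeClass n X p c →
        c ∈ algebraicClasses X p) :
    PadicSemiregularLift.HodgeAbelianVarieties := by
  intro A
  have hA : IsSmoothProjective A.dim A.X := AbelianVariety.isSmoothProjective_holds (A := A)
  exact ⟨nonempty_hodgeModel_holds hA,
    fun p c hc hpp ↦ habs hA p c (hA₂ hA p c hc (hA₁ A hA p c hc hpp))⟩

/-- **`AbsoluteReduction` and `HCOverNumberFields` together give the Hodge conjecture for every complex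
abelian variety** (CONDITIONAL on André's two facts): route `BoundaryReadout`'s support
`AbsoluteReduction` (stmt-HodgeConjecture-15945) fed the crux yields "absolute Hodge ⇒ algebraic" on all
smooth projective complex varieties, and §1 applies. [cite: Andre1996Motifs, Thm. 0.6.2 and Prop. 2.5.1]
[cite: Voisin2007HodgeLoci, Prop. 1.2] -/
theorem hodgeAbelianVarieties_of_absoluteReduction
    (hA₁ : Andre1996_hodgeClasses_abelianVariety_motivated)
    (hA₂ : Andre1996_isAbsoluteHodgeClass_of_mem_motivatedClasses)
    (hR : BoundaryReadout.AbsoluteReduction) (hQ : BoundaryReadout.HCOverNumberFields) :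
    PadicSemiregularLift.HodgeAbelianVarieties :=
  hodgeAbelianVarieties_of_absoluteHodge_algebraic hA₁ hA₂ fun _ _ hX ↦ (hR hQ hX).2

/-! ### 2. The crux settles the Hodge conjecture for all complex abelian varieties -/

/-- **stmt-HodgeConjecture-1070 ⟹ stmt-HodgeConjecture-1333 (CONDITIONAL on Voisin 2007 Prop. 1.2 and
André 1996 Thm. 0.6.2 / Prop. 2.5.1).** If the Hodge conjecture holds for every smooth projective
complex variety definable over a number field, then it holds for EVERY complex abelian variety
(`PadicSemiregularLift.HodgeAbelianVarieties`), arithmetic or not: `HCOverNumberFields` ⟹ HC for all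
`X₀ ⊗_{ℚ̄,σ} ℂ` (`hodgeConjectureQbar_of_hcOverNumberFields`) ⟹ absolute Hodge classes are algebraic
everywhere (Voisin, `absoluteReduction_of_voisin2007`) ⟹ Hodge classes on abelian varieties, being
motivated hence absolute Hodge (André), are algebraic. [cite: Voisin2007HodgeLoci, Prop. 1.2 and Rem. 1.4]
[cite: Andre1996Motifs, Thm. 0.6.2 and Prop. 2.5.1] -/
theorem hodgeAbelianVarieties_of_hcOverNumberFields
    (hV : voisin2007_hodgeConjecture_absolute_of_qbar)
    (hA₁ : Andre1996_hodgeClasses_abelianVariety_motivated)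
    (hA₂ : Andre1996_isAbsoluteHodgeClass_of_mem_motivatedClasses)
    (hQ : BoundaryReadout.HCOverNumberFields) :
    PadicSemiregularLift.HodgeAbelianVarieties :=
  hodgeAbelianVarieties_of_absoluteReduction hA₁ hA₂ (absoluteReduction_of_voisin2007 hV) hQ

/-- The same from the `ℚ̄`-typed crux `PeriodDeficiency.HodgeConjectureQbar`
(stmt-HodgeConjecture-11596), through the landed transfer `hcOverNumberFields_of_hodgeConjectureQbar`.
[cite: Voisin2007HodgeLoci, Prop. 1.2 and Rem. 1.4] [cite: Andre1996Motifs, Thm. 0.6.2 and Prop. 2.5.1] -/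
theorem hodgeAbelianVarieties_of_hodgeConjectureQbar
    (hV : voisin2007_hodgeConjecture_absolute_of_qbar)
    (hA₁ : Andre1996_hodgeClasses_abelianVariety_motivated)
    (hA₂ : Andre1996_isAbsoluteHodgeClass_of_mem_motivatedClasses)
    (h : PeriodDeficiency.HodgeConjectureQbar) :
    PadicSemiregularLift.HodgeAbelianVarieties :=
  hodgeAbelianVarieties_of_hcOverNumberFields hV hA₁ hA₂ (hcOverNumberFields_of_hodgeConjectureQbar h)

/-! ### 3. In particular the kernel item: Weil classes (stmt-HodgeConjecture-2522) -/

/-- **stmt-HodgeConjecture-1070 ⟹ stmt-HodgeConjecture-2522 (CONDITIONAL on the same three facts).**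
The Hodge conjecture over number fields gives the algebraicity of the Weil classes on EVERY complex
abelian variety of Weil type (`TropicalCuspLift.WeilClassesAlgebraic`, the shared target of routes
`TropicalCuspLift` and `HeckeOrbitCompactness`) — not only on the arithmetic (e.g. CM) ones: through
§2 and the landed `Cruxes.HodgeAbelianVarieties.EStepSecantInduction.Stubs.WeilSector.weilClassesAlgebraic_of_hodgeAbelianVarieties`. The kernel of the crux (Weil classes
on CM abelian varieties of Weil type, open from dimension `6` on) is thus formally inside its
consequences. [cite: Weil1977HodgeRing] [cite: Voisin2007HodgeLoci, Prop. 1.2]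
[cite: Andre1996Motifs, Thm. 0.6.2 and Prop. 2.5.1] -/
theorem weilClassesAlgebraic_of_hcOverNumberFields
    (hV : voisin2007_hodgeConjecture_absolute_of_qbar)
    (hA₁ : Andre1996_hodgeClasses_abelianVariety_motivated)
    (hA₂ : Andre1996_isAbsoluteHodgeClass_of_mem_motivatedClasses)
    (hQ : BoundaryReadout.HCOverNumberFields) :
    TropicalCuspLift.WeilClassesAlgebraic :=
  Cruxes.HodgeAbelianVarieties.EStepSecantInduction.Stubs.WeilSector.weilClassesAlgebraic_of_hodgeAbelianVarieties
    (hodgeAbelianVarieties_of_hcOverNumberFields hV hA₁ hA₂ hQ)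

/-- The two route spellings of the shared target stmt-HodgeConjecture-2522 are one statement
(`Iff.rfl`). [folklore] -/
theorem heckeOrbitCompactness_weilClassesAlgebraic_iff :
    HeckeOrbitCompactness.WeilClassesAlgebraic ↔ TropicalCuspLift.WeilClassesAlgebraic :=
  Iff.rfl

/-- `HCOverNumberFields ⟹ HeckeOrbitCompactness.WeilClassesAlgebraic` (route `HeckeOrbitCompactness`'s
spelling of stmt-HodgeConjecture-2522; CONDITIONAL on the same three facts). [cite: Weil1977HodgeRing]
[cite: Voisin2007HodgeLoci, Prop. 1.2] [cite: Andre1996Motifs, Thm. 0.6.2 and Prop. 2.5.1] -/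
theorem heckeOrbitCompactness_weilClassesAlgebraic_of_hcOverNumberFields
    (hV : voisin2007_hodgeConjecture_absolute_of_qbar)
    (hA₁ : Andre1996_hodgeClasses_abelianVariety_motivated)
    (hA₂ : Andre1996_isAbsoluteHodgeClass_of_mem_motivatedClasses)
    (hQ : BoundaryReadout.HCOverNumberFields) :
    HeckeOrbitCompactness.WeilClassesAlgebraic :=
  heckeOrbitCompactness_weilClassesAlgebraic_iff.2 (weilClassesAlgebraic_of_hcOverNumberFields hV hA₁ hA₂ hQ)

end Summit.HodgeConjecture.HodgeConjecture.Theorems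

end
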